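import Summits.Ventures.CertifiedManyBodySolver.Rows.AndersonClusterSymmetries
import Literature.MathematicalPhysics.QuantumLattice.HubbardLiebBasis

/-!
# The Anderson cluster operator in Lieb's two-species coordinates

Support file for the certified many-body solver (venture `CertifiedManyBodySolver`, lane A rows):
first certified bounds; not a superconductivity verdict; every number certified or labelled float.

Main result `andersonCluster_mulVec_toFock`: in Lieb's coordinates `M ↦ ψ_M = toFock A M` with the
particle–hole transformation on the down spins twisted by the sign `(-1)^x` of the even sublattice
`A = evenSub Λ'` of the cluster, the weighted particle–hole symmetric cluster operator
`h = andersonCluster Λ' t U w v` (`U`, site weights `v ≥ 0`, arbitrary real bond weights `w`)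
acts as
`h ψ_M = ψ_{𝓛 M + c M}` with the graded Lieb operator
`𝓛 M = K M + M K - U Σ_y L_y M L_y` (`liebOp (liebHop Λ' t w) (liebOcc Λ' v) (-U)`),
`K = t Σ_bonds w_b T_b` the weighted spinless hopping matrix, `L_y = √v_y (n_y - ½)` and the
constant `c = (U/4) Σ_y v_y` (`liebShift`). The hopping part is assembled bond by bond from the
tree's one-graph identity `LiebTwo.hamiltonian_mulVec_toFock` (each bond of `ℤ^d` joins the two
sublattices, `edge_adj_evenSub`); the weighted on-site part
`(U/4) v_y (2n↑n↓ - n↑ - n↓ + 1) = U v_y (n↑ - ½)(n↓ - ½)` becomes `-U L_y M L_y + (U v_y/4) M`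
under the particle–hole transformation (`phSiteTerm_mulVec_toFock`).

References: E. H. Lieb, Phys. Rev. Lett. **62** (1989) 1201, proof of Theorem 2, eqs. (4)–(5);
P. W. Anderson, Phys. Rev. **83** (1951) 1260.
-/

namespace Summit.Ventures.CertifiedManyBodySolver.Rows

open Matrix Finset Literature.MathematicalPhysics.QuantumLattice
  Literature.MathematicalPhysics.QuantumLattice.AndersonCluster Literature.Probability.LatticeModels
open scoped ComplexOrder

/-! ### Lieb's change of basis is linear -/

section Linear

variable {Λ : Type*} [LinearOrder Λ] [Fintype Λ]

/-- Lieb's change of basis `M ↦ ψ_M` as a `ℂ`-linear map. [cite: LiebPRL1989, proof of Theorem 2] -/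
def toFockₗ (A : Finset Λ) : Matrix (Finset Λ) (Finset Λ) ℂ →ₗ[ℂ] Fock (Orb Λ) where
  toFun := LiebTwo.toFock A
  map_add' := LiebTwo.toFock_add A
  map_smul' := LiebTwo.toFock_smul A

/-- `toFockₗ` is `toFock`. [folklore] -/
@[simp] theorem toFockₗ_apply (A : Finset Λ) (M : Matrix (Finset Λ) (Finset Λ) ℂ) :
    toFockₗ A M = LiebTwo.toFock A M := rfl

/-- `toFock` is additive over finite sums. [folklore] -/
theorem toFock_sum {ι : Type*} (A : Finset Λ) (s : Finset ι)
    (f : ι → Matrix (Finset Λ) (Finset Λ) ℂ) :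
    LiebTwo.toFock A (∑ i ∈ s, f i) = ∑ i ∈ s, LiebTwo.toFock A (f i) := by
  rw [← toFockₗ_apply, map_sum]
  rfl

/-- `toFock` commutes with negation. [folklore] -/
theorem toFock_neg (A : Finset Λ) (M : Matrix (Finset Λ) (Finset Λ) ℂ) :
    LiebTwo.toFock A (-M) = -LiebTwo.toFock A M := by
  rw [← toFockₗ_apply, map_neg]
  rfl

/-- **The particle–hole symmetric site term in Lieb's coordinates**: with the down species
hole-transformed, `(2 n↑n↓ - n↑ - n↓ + 1) ψ_M = ψ_{n M + M n - 2 n M n}` (`n = n_y` the spinless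
occupation matrix): the coefficient at `(α, β)` is `[y∈α] + [y∈β] - 2[y∈α][y∈β]`, the indicator
that exactly one of "`y` carries an up electron", "`y` carries a down hole" holds.
[cite: LiebPRL1989, proof of Theorem 2, eq. (5)] -/
theorem phSiteTerm_mulVec_toFock (A : Finset Λ) (y : Λ) (M : Matrix (Finset Λ) (Finset Λ) ℂ) :
    ((2 : ℂ) • (numberOp y 0 * numberOp y 1) - (numberOp y 0 + numberOp y 1) + 1 :
        Matrix (Finset (Orb Λ)) (Finset (Orb Λ)) ℂ) *ᵥ LiebTwo.toFock A M =
      LiebTwo.toFock A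
        (numberAt y * M + M * numberAt y - (2 : ℂ) • (numberAt y * M * numberAt y)) := by
  funext s
  simp only [add_mulVec, sub_mulVec, Matrix.smul_mulVec, one_mulVec, Pi.add_apply, Pi.sub_apply,
    Pi.smul_apply, smul_eq_mul, LiebTwo.numberOp_mul_numberOp_mulVec, LiebTwo.numberOp_mulVec,
    LiebTwo.toFock, numberAt_eq_diagonal, Matrix.add_apply, Matrix.sub_apply, Matrix.smul_apply,
    diagonal_mul, mul_diagonal, Finset.mem_compl, mem_upPart, mem_downPart]
  by_cases h0 : orb y 0 ∈ s <;> by_cases h1 : orb y 1 ∈ s <;>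
    simp only [h0, h1, and_self, and_true, and_false, not_true_eq_false, not_false_eq_true,
      ↓reduceIte] <;> ring

end Linear

/-! ### Lieb's matrices `K`, `L_y` for the weighted cluster -/

section Cluster

variable {d : ℕ} {Λ' : Finset (Site d)}

variable (Λ') in
/-- The even sublattice `A = {x ∈ Λ' : Σ_j x_j even}` of the window (a colour class of every
nearest-neighbour bond). [cite: LiebPRL1989, Theorem 2 (bipartite hypothesis)] -/
def evenSub : Finset (PolySite Λ') := univ.filter fun y => Even (∑ j, (ofLex y.1) j)

/-- A nearest-neighbour bond joins the two sublattices. [folklore] -/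
theorem pt_add_unitVec_mem_evenSub_iff (y : PolySite Λ') (i : Fin d)
    (h : ofLex y.1 + unitVec i ∈ Λ') :
    PolySite.pt (ofLex y.1 + unitVec i) h ∈ evenSub Λ' ↔ y ∉ evenSub Λ' := by
  simp only [evenSub, Finset.mem_filter, Finset.mem_univ, true_and, PolySite.ofLex_coe_pt]
  have hs : (∑ j, (ofLex y.1 + unitVec i) j) = (∑ j, (ofLex y.1) j) + 1 := by
    simp [unitVec, Finset.sum_add_distrib, Pi.single_apply]
  rw [hs, Int.even_add_one]

/-- The even sublattice is a colour class of every one-bond graph of the window.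
[cite: LiebPRL1989, Theorem 2 (bipartite hypothesis)] -/
theorem edge_adj_evenSub (y : PolySite Λ') (i : Fin d) (h : ofLex y.1 + unitVec i ∈ Λ') :
    ∀ x x' : PolySite Λ', (SimpleGraph.edge y (PolySite.pt (ofLex y.1 + unitVec i) h)).Adj x x' →
      (x ∈ evenSub Λ' ↔ x' ∉ evenSub Λ') := by
  intro x x' hxx'
  have hz := pt_add_unitVec_mem_evenSub_iff y i h
  rcases (edge_adj_iff_of_ne (ne_pt_add_unitVec y i h) _ _).1 hxx' with ⟨rfl, rfl⟩ | ⟨rfl, rfl⟩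
  · rw [hz, not_not]
  · exact hz

/-- The spinless hopping matrix `K_{x,x+eᵢ}` (`t = 1`) of one bond of the window (`0` if the
bond leaves the window). [cite: LiebPRL1989, eq. (3)] -/
noncomputable def bondHop (y : PolySite Λ') (i : Fin d) :
    Matrix (Finset (PolySite Λ')) (Finset (PolySite Λ')) ℂ :=
  if h : ofLex y.1 + unitVec i ∈ Λ' then
    hoppingMatrix (SimpleGraph.edge y (PolySite.pt (ofLex y.1 + unitVec i) h)) 1 else 0

variable (Λ') in
/-- The weighted spinless hopping matrix `Σ_{x,i} w(x,i) K_{x,x+eᵢ}` (before the factor `t`).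
[cite: LiebPRL1989, eq. (3)] -/
noncomputable def bareHop (w : Site d → Fin d → ℝ) :
    Matrix (Finset (PolySite Λ')) (Finset (PolySite Λ')) ℂ :=
  ∑ y : PolySite Λ', ∑ i : Fin d, ((w (ofLex y.1) i : ℝ) : ℂ) • bondHop y i

variable (Λ') in
/-- **Lieb's matrix `K`** of the weighted cluster: `K = t Σ_{x,i} w(x,i) K_{x,x+eᵢ}`, the same real
symmetric matrix for both spin species. [cite: LiebPRL1989, eq. (3)] -/
noncomputable def liebHop (t : ℝ) (w : Site d → Fin d → ℝ) :
    Matrix (Finset (PolySite Λ')) (Finset (PolySite Λ')) ℂ :=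
  (t : ℂ) • bareHop Λ' w

variable (Λ') in
/-- **Lieb's matrices `L_y`** of the weighted cluster: `L_y = √(v y) (n_y - ½)`, diagonal with
entries `±√(v y)/2`. [cite: LiebPRL1989, eq. (3)] -/
noncomputable def liebOcc (v : Site d → ℝ) (y : PolySite Λ') :
    Matrix (Finset (PolySite Λ')) (Finset (PolySite Λ')) ℂ :=
  diagonal fun α => ((Real.sqrt (v (ofLex y.1)) * (if y ∈ α then 1 / 2 else -(1 / 2)) : ℝ) : ℂ)

variable (Λ') in
/-- The constant `c = (U/4) Σ_{y ∈ Λ'} v y` of the Lieb form `h ψ_M = ψ_{𝓛 M + c M}`.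
[cite: LiebPRL1989, eq. (5)] -/
noncomputable def liebShift (U : ℝ) (v : Site d → ℝ) : ℝ := U / 4 * ∑ y : PolySite Λ', v (ofLex y.1)

/-- An out-of-window bond, or a pair of configurations of different particle number, gives a
zero entry of `K_{x,x+eᵢ}`. [cite: LiebPRL1989, Remark (2)] -/
theorem bondHop_apply_eq_zero (y : PolySite Λ') (i : Fin d) {α γ : Finset (PolySite Λ')}
    (hne : α.card ≠ γ.card) : bondHop y i α γ = 0 := by
  unfold bondHop
  split_ifs with h
  · by_contra hK
    exact hne (LiebTwo.hoppingMatrix_apply_ne_zero _ hK)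
  · rfl

/-- `K_{x,x+eᵢ}` is Hermitian. [cite: LiebPRL1989, Remark (1)] -/
theorem bondHop_conjTranspose (y : PolySite Λ') (i : Fin d) : (bondHop y i)ᴴ = bondHop y i := by
  unfold bondHop
  split_ifs with h
  · exact hoppingMatrix_conjTranspose 1
  · exact conjTranspose_zero

/-- **`K` is Hermitian** (real symmetric). [cite: LiebPRL1989, Remark (1)] -/
theorem liebHop_conjTranspose (t : ℝ) (w : Site d → Fin d → ℝ) :
    (liebHop Λ' t w)ᴴ = liebHop Λ' t w := by
  simp only [liebHop, bareHop, conjTranspose_smul, conjTranspose_sum, Complex.star_def,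
    Complex.conj_ofReal, bondHop_conjTranspose]

/-- **`K` conserves the particle number**: `K_{αγ} ≠ 0 → |α| = |γ|`.
[cite: LiebPRL1989, Remark (2)] -/
theorem liebHop_apply_ne_zero (t : ℝ) (w : Site d → Fin d → ℝ) :
    ∀ α γ : Finset (PolySite Λ'), liebHop Λ' t w α γ ≠ 0 → α.card = γ.card := by
  intro α γ h
  by_contra hne
  apply h
  simp only [liebHop, bareHop, Matrix.smul_apply, Matrix.sum_apply, smul_eq_mul,
    bondHop_apply_eq_zero _ _ hne, mul_zero, Finset.sum_const_zero]

/-- **`L_y` is Hermitian** (real diagonal). [cite: LiebPRL1989, eq. (3)] -/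
theorem liebOcc_conjTranspose (v : Site d → ℝ) :
    ∀ y : PolySite Λ', (liebOcc Λ' v y)ᴴ = liebOcc Λ' v y := by
  intro y
  rw [liebOcc, diagonal_conjTranspose]
  congr 1
  funext α
  simp only [Pi.star_apply, Complex.star_def, Complex.conj_ofReal]

/-- **`L_y` is diagonal**, hence number conserving. [cite: LiebPRL1989, eq. (3)] -/
theorem liebOcc_apply_ne_zero (v : Site d → ℝ) :
    ∀ (y : PolySite Λ') (α γ : Finset (PolySite Λ')), liebOcc Λ' v y α γ ≠ 0 → α.card = γ.card := by
  intro y α γ h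
  by_cases e : α = γ
  · rw [e]
  · exact absurd (diagonal_apply_ne _ e) h

/-- **The site identity behind eq. (5)**: `v (n M + M n - 2 n M n) = -2 L_y M L_y + (v/2) M` with
`L_y = √v (n_y - ½)` (`v ≥ 0`). [cite: LiebPRL1989, proof of Theorem 2, eq. (5)] -/
theorem smul_phSiteLieb_eq {v : Site d → ℝ} (y : PolySite Λ') (hv : 0 ≤ v (ofLex y.1))
    (M : Matrix (Finset (PolySite Λ')) (Finset (PolySite Λ')) ℂ) :
    ((v (ofLex y.1) : ℝ) : ℂ) •
        (numberAt y * M + M * numberAt y - (2 : ℂ) • (numberAt y * M * numberAt y)) =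
      (-2 : ℂ) • (liebOcc Λ' v y * M * liebOcc Λ' v y) +
        ((v (ofLex y.1) : ℝ) : ℂ) • ((1 / 2 : ℂ) • M) := by
  have hr : ((Real.sqrt (v (ofLex y.1)) : ℝ) : ℂ) * ((Real.sqrt (v (ofLex y.1)) : ℝ) : ℂ) =
      ((v (ofLex y.1) : ℝ) : ℂ) := by
    rw [← Complex.ofReal_mul, Real.mul_self_sqrt hv]
  ext α β
  simp only [liebOcc, numberAt_eq_diagonal, Matrix.smul_apply, Matrix.add_apply, Matrix.sub_apply,
    diagonal_mul, mul_diagonal, smul_eq_mul]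
  by_cases ha : y ∈ α <;> by_cases hb : y ∈ β <;> simp only [ha, hb, if_true, if_false] <;>
    push_cast <;>
    first
    | linear_combination (M α β / 2) * hr
    | linear_combination (-(M α β) / 2) * hr

/-- **One bond in Lieb's coordinates**: `T_{x,x+eᵢ} ψ_M = -ψ_{K_b M + M K_b}`.
[cite: LiebPRL1989, proof of Theorem 2, eq. (4)] -/
theorem clusterBondKinetic_mulVec_toFock
    (M : Matrix (Finset (PolySite Λ')) (Finset (PolySite Λ')) ℂ)
    (y : PolySite Λ') (i : Fin d) :
    clusterBondKinetic Λ' y i *ᵥ LiebTwo.toFock (evenSub Λ') M =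
      LiebTwo.toFock (evenSub Λ') (-(bondHop y i * M + M * bondHop y i)) := by
  rw [clusterBondKinetic_eq_dite]
  unfold bondHop
  split_ifs with h
  · rw [neg_mulVec, LiebTwo.hamiltonian_mulVec_toFock _ (evenSub Λ') (edge_adj_evenSub y i h)
      1 0 M, toFock_neg]
    simp [LiebTwo.liebOperator, liebOp]
  · simp

variable (Λ') in
/-- **The Anderson cluster operator in Lieb's coordinates** (spin-reflection form): for the even
sublattice `A` and every coefficient matrix `M`,
`h(w,v) ψ_M = ψ_{K M + M K - U Σ_y L_y M L_y + c M}` with `K = t Σ w K_b` (`liebHop`),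
`L_y = √(v y)(n_y - ½)` (`liebOcc`) and `c = (U/4) Σ_y v y` (`liebShift`), i.e.
`h ψ_M = ψ_{𝓛(M) + c M}` with `𝓛 = liebOp K L (-U)` of `LiebSpinReflection`. This is Lieb's
eqs. (4)–(5) for the bond/site-weighted, particle–hole symmetric cluster Hamiltonian of the
certificate rows. [cite: LiebPRL1989, proof of Theorem 2, eqs. (4)–(5)] -/
theorem andersonCluster_mulVec_toFock (t U : ℝ) (w : Site d → Fin d → ℝ) {v : Site d → ℝ}
    (hv : ∀ x, 0 ≤ v x) (M : Matrix (Finset (PolySite Λ')) (Finset (PolySite Λ')) ℂ) :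
    andersonCluster Λ' t U w v *ᵥ LiebTwo.toFock (evenSub Λ') M =
      LiebTwo.toFock (evenSub Λ') (liebOp (liebHop Λ' t w) (liebOcc Λ' v) (-U) M +
        ((liebShift Λ' U v : ℝ) : ℂ) • M) := by
  have hK : (∑ y : PolySite Λ', ∑ i : Fin d,
      ((w (ofLex y.1) i : ℝ) : ℂ) • clusterBondKinetic Λ' y i) *ᵥ
      LiebTwo.toFock (evenSub Λ') M =
      LiebTwo.toFock (evenSub Λ') (∑ y : PolySite Λ', ∑ i : Fin d,
        ((w (ofLex y.1) i : ℝ) : ℂ) • -(bondHop y i * M + M * bondHop y i)) := by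
    simp only [Matrix.sum_mulVec, Matrix.smul_mulVec, clusterBondKinetic_mulVec_toFock,
      toFock_sum, LiebTwo.toFock_smul]
  have hV : (∑ y : PolySite Λ', ((v (ofLex y.1) : ℝ) : ℂ) •
      ((2 : ℂ) • (numberOp y 0 * numberOp y 1) - (numberOp y 0 + numberOp y 1) + 1 :
        FermionOp Λ')) *ᵥ
      LiebTwo.toFock (evenSub Λ') M =
      LiebTwo.toFock (evenSub Λ') (∑ y : PolySite Λ',
        ((-2 : ℂ) • (liebOcc Λ' v y * M * liebOcc Λ' v y) +
          ((v (ofLex y.1) : ℝ) : ℂ) • ((1 / 2 : ℂ) • M))) := by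
    simp only [Matrix.sum_mulVec, Matrix.smul_mulVec, phSiteTerm_mulVec_toFock,
      ← LiebTwo.toFock_smul, smul_phSiteLieb_eq _ (hv _), toFock_sum]
  unfold andersonCluster
  rw [add_mulVec, Matrix.smul_mulVec, Matrix.smul_mulVec, hK, hV, ← LiebTwo.toFock_smul,
    ← LiebTwo.toFock_smul, ← LiebTwo.toFock_add]
  congr 1
  simp only [liebOp, liebHop, bareHop, liebShift, Finset.sum_add_distrib, ← Finset.smul_sum,
    ← Finset.sum_smul, smul_neg, smul_add, Finset.sum_neg_distrib, Finset.sum_mul, Finset.mul_sum,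
    smul_mul_assoc, mul_smul_comm]
  push_cast
  simp only [← Finset.mul_sum]
  module

end Cluster

end Summit.Ventures.CertifiedManyBodySolver.Rows
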